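import Summits.Langlands.Langlands.Theses.PolarisationCarving

/-!
# Glue of the weight-string split of `UnpolarisedTRCMTypeAutomorphy` (route PolarisationCarving rev 1)

Closes the glue item stmt-Langlands-32661 of `route-Langlands-PolarisationCarving` generated by
`--split UnpolarisedTRCMTypeAutomorphy --glue-decl-name UnpolarisedTRCMTypeAutomorphy_of_split`:
`ConsecutiveWeightAutomorphy → GappedWeightAutomorphy → IrregularUnpolarisedAutomorphy → UnpolarisedTRCMTypeAutomorphy`
(CW → GW → IW → UNP).  Pure logic: two excluded middles on the inlined HT-weight-string dial (CONS ⊆ REG).  This is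
the PROOF section of the lens-6 g9 node kit `nodes/lens-6-g9-WeightStringCarving.split_glue.lean` (decomp-langlands,
2026-08-30; crit-1 CLEARED row 112), verbatim.  No definitions.
-/

set_option linter.dupNamespace false -- project-wide option; `Summit.Langlands.Langlands` is the mandated namespace

namespace Summit.Langlands.Langlands.Theorems

open scoped Classical
open Filter
open Summit.Langlands.Langlands.Theses

/-- The layer-2 glue of the WeightStringCarving split of UNP = `PolarisationCarving.UnpolarisedTRCMTypeAutomorphy`:
CW → GW → IW → UNP (pure logic — TWO excluded middles on the inlined weight-string dial, CONS ⊆ REG). -/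
theorem UnpolarisedTRCMTypeAutomorphy_of_split_proof : PolarisationCarving.UnpolarisedTRCMTypeAutomorphy_of_split := by
  intro hCW hGW hIW K _ _ n hcpt hn ℓ _ ι ρ hirr hgeo htw hunp
  by_cases hs : (∀ (v : IsDedekindDomain.HeightOneSpectrum (NumberField.RingOfIntegers K)) (hv : ((ℓ : ℕ) : NumberField.RingOfIntegers K) ∈ v.asIdeal) (τ : v.adicCompletion K →+* PadicAlgCl ℓ), Continuous τ → (ρ.labelledHodgeTateWeightsAt v (Literature.NumberTheory.PAdicHodge.fontainePstAdicCompletion v ℓ hv).algebra (Literature.NumberTheory.PAdicHodge.fontainePstAdicCompletion v ℓ hv).𝔅 τ).Nodup ∧ ∀ a ∈ (ρ.labelledHodgeTateWeightsAt v (Literature.NumberTheory.PAdicHodge.fontainePstAdicCompletion v ℓ hv).algebra (Literature.NumberTheory.PAdicHodge.fontainePstAdicCompletion v ℓ hv).𝔅 τ), ∀ b ∈ (ρ.labelledHodgeTateWeightsAt v (Literature.NumberTheory.PAdicHodge.fontainePstAdicCompletion v ℓ hv).algebra (Literature.NumberTheory.PAdicHodge.fontainePstAdicCompletion v ℓ hv).𝔅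 τ), ∀ c : ℤ, a ≤ c → c ≤ b → c ∈ (ρ.labelledHodgeTateWeightsAt v (Literature.NumberTheory.PAdicHodge.fontainePstAdicCompletion v ℓ hv).algebra (Literature.NumberTheory.PAdicHodge.fontainePstAdicCompletion v ℓ hv).𝔅 τ))
  · exact hCW K n hcpt hn ℓ ι ρ hirr hgeo htw ⟨hunp, hs⟩
  · by_cases hr : (∀ (v : IsDedekindDomain.HeightOneSpectrum (NumberField.RingOfIntegers K)) (hv : ((ℓ : ℕ) : NumberField.RingOfIntegers K) ∈ v.asIdeal) (τ : v.adicCompletion K →+* PadicAlgCl ℓ), Continuous τ → (ρ.labelledHodgeTateWeightsAt v (Literature.NumberTheory.PAdicHodge.fontainePstAdicCompletion v ℓ hv).algebra (Literature.NumberTheory.PAdicHodge.fontainePstAdicCompletion v ℓ hv).𝔅 τ).Nodup)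
    · exact hGW K n hcpt hn ℓ ι ρ hirr hgeo htw ⟨hunp, hr, hs⟩
    · exact hIW K n hcpt hn ℓ ι ρ hirr hgeo htw ⟨hunp, hr⟩

end Summit.Langlands.Langlands.Theorems
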